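import Summits.RiemannHypothesis.RiemannHypothesis.Theorems.WeilColumnThetaMellinTransform
import HarnessLib

/-!
# The truncated tail `T_R = G₀·ψ_R·(1−χ)` is a tail with the cut `χ̃ = 1 − ψ_R(1−χ)` (PR Step 3 bookkeeping)

WEIL column (LADDER-RH, W-P(P2); tier-1 `ThetaCertificateSound`, THETA-ASSIGN §6 Step 3). handoff-prove-2's tail lemmas
(`WeilColumnThetaTailNorms`: envelopes, `L²` norms, derivative) and this seat's `WeilColumnTruncationError` are stated for
`expProfile Θ·(1 − χ)` with a cut `χ ∈ [0,1]`, `χ = 1` on `[x₁,∞)`, `C¹`, `|χ′| ≤ L`. The truncated tail `G₀·ψ·(1−χ)` is of the same form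
with `χ̃ := 1 − ψ·(1−χ)`: `truncCut_mem_Icc`, `truncCut_eq_one`, `hasDerivAt_truncCut`, `abs_deriv_truncCut_le` (`|χ̃′| ≤ Lψ + L`),
`continuous_deriv_truncCut`, and the identity `expProfile_mul_step_mul_cut`. So every tail lemma applies to `T_R` with `L ↦ L + Lψ`,
uniformly in `R`. RH-free; nothing here bears on the truth of RH.
-/

set_option linter.dupNamespace false

noncomputable section

open Set Complex
open scoped Real
open Literature.NumberTheory.LFunctions

namespace Summit.RiemannHypothesis.RiemannHypothesis.Theorems.WeilColumn.ThetaMellin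

variable {ψ ψ' χ χ' : ℝ → ℝ} {Lψ L x₁ : ℝ}

/-- The combined cut `χ̃ = 1 − ψ·(1 − χ)`. -/
def truncCut (ψ χ : ℝ → ℝ) (x : ℝ) : ℝ := 1 - ψ x * (1 - χ x)

/-- `χ̃ ∈ [0,1]` when `ψ, χ ∈ [0,1]`. [folklore] -/
theorem truncCut_mem_Icc (hψ : ∀ x, ψ x ∈ Icc (0 : ℝ) 1) (hχ : ∀ x, χ x ∈ Icc (0 : ℝ) 1) (x : ℝ) :
    truncCut ψ χ x ∈ Icc (0 : ℝ) 1 := by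
  obtain ⟨h1, h2⟩ := hψ x; obtain ⟨h3, h4⟩ := hχ x
  unfold truncCut
  constructor <;> nlinarith [mul_nonneg h1 (sub_nonneg.mpr h4), mul_le_mul h2 (sub_le_self 1 h3) (sub_nonneg.mpr h4) zero_le_one]

/-- `χ̃ = 1` where `χ = 1` (in particular on `[x₁, ∞)`). [folklore] -/
theorem truncCut_eq_one (hχ1 : ∀ x, x₁ ≤ x → χ x = 1) {x : ℝ} (hx : x₁ ≤ x) : truncCut ψ χ x = 1 := by
  simp [truncCut, hχ1 x hx]

/-- `χ̃ = χ` where `ψ = 1` (in particular on `[−R, ∞)` for the smooth step). [folklore] -/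
theorem truncCut_eq_of_step_eq_one {x : ℝ} (hψ1 : ψ x = 1) : truncCut ψ χ x = χ x := by
  simp [truncCut, hψ1]

/-- `χ̃′ = −ψ′(1−χ) + ψχ′`. [folklore] -/
theorem hasDerivAt_truncCut (hψ' : ∀ x, HasDerivAt ψ (ψ' x) x) (hχ' : ∀ x, HasDerivAt χ (χ' x) x) (x : ℝ) :
    HasDerivAt (truncCut ψ χ) (-(ψ' x * (1 - χ x)) + ψ x * χ' x) x := by
  have h := ((hψ' x).mul ((hχ' x).const_sub 1)).const_sub 1
  refine h.congr_deriv ?_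
  ring

/-- `|χ̃′| ≤ Lψ + L` (`|ψ| ≤ 1`, `|1 − χ| ≤ 1`). [folklore] -/
theorem abs_deriv_truncCut_le (hψ : ∀ x, ψ x ∈ Icc (0 : ℝ) 1) (hχ : ∀ x, χ x ∈ Icc (0 : ℝ) 1)
    (hLψ : ∀ x, |ψ' x| ≤ Lψ) (hL : ∀ x, |χ' x| ≤ L) (x : ℝ) :
    |-(ψ' x * (1 - χ x)) + ψ x * χ' x| ≤ Lψ + L := by
  obtain ⟨h1, h2⟩ := hψ x; obtain ⟨h3, h4⟩ := hχ x
  have ha : |ψ' x * (1 - χ x)| ≤ Lψ := by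
    rw [abs_mul, abs_of_nonneg (sub_nonneg.mpr h4)]
    calc |ψ' x| * (1 - χ x) ≤ Lψ * 1 := mul_le_mul (hLψ x) (by linarith) (by linarith) ((abs_nonneg _).trans (hLψ x))
      _ = Lψ := mul_one _
  have hb : |ψ x * χ' x| ≤ L := by
    rw [abs_mul, abs_of_nonneg h1]
    calc ψ x * |χ' x| ≤ 1 * L := mul_le_mul h2 (hL x) (abs_nonneg _) zero_le_one
      _ = L := one_mul _
  calc |-(ψ' x * (1 - χ x)) + ψ x * χ' x| ≤ |-(ψ' x * (1 - χ x))| + |ψ x * χ' x| := abs_add_le _ _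
    _ ≤ Lψ + L := by rw [abs_neg]; exact add_le_add ha hb

/-- Continuity of `χ̃′` from continuity of `ψ, ψ′, χ, χ′`. [folklore] -/
theorem continuous_deriv_truncCut (hψc : Continuous ψ) (hψ'c : Continuous ψ') (hχc : Continuous χ) (hχ'c : Continuous χ') :
    Continuous fun x => -(ψ' x * (1 - χ x)) + ψ x * χ' x := by
  fun_prop

/-- **`T_R` is a tail with the cut `χ̃`**: `G₀·ψ·(1−χ) = G₀·(1 − χ̃)` pointwise. [folklore] -/
theorem expProfile_mul_step_mul_cut (Θ : ℝ → ℂ) (ψ χ : ℝ → ℝ) (x : ℝ) :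
    expProfile Θ x * (ψ x : ℂ) * (((1 - χ x : ℝ)) : ℂ) = expProfile Θ x * (((1 - truncCut ψ χ x : ℝ)) : ℂ) := by
  simp only [truncCut]; push_cast; ring

end Summit.RiemannHypothesis.RiemannHypothesis.Theorems.WeilColumn.ThetaMellin
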